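import Mathlib
import Summits.Ventures.PercRepro2.A3CutFMoFibres
import Summits.Ventures.PercRepro2.LeafStep

/-!
# The (HCOV)-level Bernstein expansion along a pendant part
(blind cell PercRepro2, night-1 g32; proofs/NIGHT1-G32.md §6 (E4))

Let `x` be a cut vertex with the four marks in `VB ∪ {x}` and `v` on the mark-free `A`-side,
`c = P(v ↔ x)`.  Every `v`-moment of p1's (HCOV) vocabulary is a product-law image of the
corresponding `x`-moment: `P(Q, a_i ↔ v, X) = c · P(Q, a_i ↔ x, X)` for every `B`-side `X`
(`prob_Q_conn_v_inter`), hence `EQb3(v) = c·EQb3(x)`, `EQb3o(v) = c·EQb3o(x)`, `EQ3(v) = c·EQ3(x)`,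
`EQ3o(v) = c·EQ3o(x)`, and `P(PD_v, X) = (1 − c)·P(Q, X) + c·P(PD_x, X)` (`prob_PD_v_inter`), hence
`PDbo`, `PDb`, `D_o`, `D` at `v`.  Substituting into the definition of `Gc`:

  **`Gc_cut`**: `Gc(v) = (1 − c)² · T₀ + 2c(1 − c) · R½(x) + c² · Gc(x)`

— p1's leaf Bernstein form `LeafStep.Gc_leaf` with the leaf weight replaced by the connection
probability of the part (exact check: mining/night-1/g32/check_gc_cut.py, 210/210).  Consequently
**`HCov_cut_of_leafRow`**: (HCOV)(x) ∧ row 2′LEAF at `x` (`0 ≤ R½(x)`) ⟹ (HCOV)(v).  Standard axioms.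
-/

namespace Summit.Ventures.PercRepro2

open UnionCluster CovForm CutV

namespace CovForm

namespace A3Fibre

section CutMoments

variable {V : Type*} {E : Type*} [Fintype V] [DecidableEq V] [Fintype E] [DecidableEq E]
  {R : Type*} [Field R] [LinearOrder R] [IsStrictOrderedRing R] {ends : E → Sym2 V} {x : V}
  {VA VB : Finset V} {EA EB : Set E} [DecidablePred (· ∈ EA)] [DecidablePred (· ∈ EB)] {p : E → R}
  {o a₁ a₂ b v : V}

omit [Fintype V] [DecidableEq V] [Fintype E] [DecidableEq E] [Field R] [LinearOrder R]
  [IsStrictOrderedRing R] [DecidablePred (· ∈ EA)] [DecidablePred (· ∈ EB)] in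
/-- Connection events are symmetric. -/
lemma connEvent_comm (r y : V) : connEvent ends r y = connEvent ends y r := by
  ext ω
  simp only [mem_connEvent]
  exact ⟨conn_symm, conn_symm⟩

omit [Fintype V] [LinearOrder R] [IsStrictOrderedRing R] in
/-- **The root–`v` masses across the cut**: for `v ∈ VA`, a root `r ∈ VB ∪ {x}` and a `B`-side `X`,
`P(Q, r ↔ v, X) = P(v ↔ x) · P(Q, r ↔ x, X)`. -/
lemma prob_Q_conn_v_inter (h : IsCut ends x ↑VA ↑VB EA EB) (hv : v ∈ VA) {r : V}
    (hr : r ∈ insert x VB) (h1 : a₁ ∈ insert x VB) (h2 : a₂ ∈ insert x VB) (X : Set (Config E))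
    (hX : X = sideEvent EB X) :
    prob p (avoidAll ends a₂ {a₁} ∩ (connEvent ends r v ∩ X)) =
      prob p (connEvent ends v x) * prob p (avoidAll ends a₂ {a₁} ∩ (connEvent ends r x ∩ X)) := by
  rw [connEvent_o_eq h hv hr]
  have e : avoidAll ends a₂ {a₁} ∩ (sideEvent EA (connEvent ends v x) ∩ sideEvent EB (connEvent ends x r) ∩ X) =
      sideEvent EA (connEvent ends v x) ∩
        sideEvent EB (avoidAll ends a₂ {a₁} ∩ (connEvent ends x r ∩ X)) := by
    rw [← sideEvent_inter, ← sideEvent_inter, ← avoidAll_eq_sideEventB' h h1 h2, ← hX]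
    ext ω; simp only [Set.mem_inter_iff]; tauto
  rw [e, prob_sideEvent_inter_eq_mul p h, ← sideEvent_inter EB, ← sideEvent_inter EB,
    ← avoidAll_eq_sideEventB' h h1 h2, ← hX, ← connEvent_eq_sideEventB' h (Finset.mem_insert_self x VB) hr,
    connEvent_comm x r, ← connEvent_vx_eq_sideEvent h hv]

omit [Fintype V] in
/-- **The `PD_v` masses across the cut**: `P(PD_v, X) = (1 − c)·P(Q, X) + c·P(PD_x, X)`. -/
lemma prob_PD_v_inter (h : IsCut ends x ↑VA ↑VB EA EB) (hv : v ∈ VA) (h1 : a₁ ∈ insert x VB)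
    (h2 : a₂ ∈ insert x VB) (X : Set (Config E)) (hX : X = sideEvent EB X) :
    prob p (PDEvent ends a₁ a₂ v ∩ X) =
      (1 - prob p (connEvent ends v x)) * prob p (avoidAll ends a₂ {a₁} ∩ X) +
        prob p (connEvent ends v x) * prob p (PDEvent ends a₁ a₂ x ∩ X) := by
  rw [LeafStep.prob_PD_inter_v, LeafStep.prob_PD_inter_v, prob_Q_conn_v_inter h hv h1 h1 h2 X hX,
    prob_Q_conn_v_inter h hv h2 h1 h2 X hX]
  ring

omit [Fintype V] [Fintype E] [DecidableEq E] [Field R] [LinearOrder R]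
  [IsStrictOrderedRing R] [DecidablePred (· ∈ EA)] in
/-- A connection event between vertices of `VB ∪ {x}` is its own `B`-side event. -/
lemma connEvent_eq_sideEventB'' (h : IsCut ends x ↑VA ↑VB EA EB) {r y : V} (hr : r ∈ insert x VB)
    (hy : y ∈ insert x VB) : connEvent ends r y = sideEvent EB (connEvent ends r y) :=
  connEvent_eq_sideEventB' h hr hy

omit [Fintype V] [Fintype E] [DecidableEq E] [Field R] [LinearOrder R]
  [IsStrictOrderedRing R] [DecidablePred (· ∈ EA)] in
/-- The intersection of two `B`-side connection events is its own `B`-side event. -/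
lemma connEvent_inter_eq_sideEventB (h : IsCut ends x ↑VA ↑VB EA EB) {r y r' y' : V}
    (hr : r ∈ insert x VB) (hy : y ∈ insert x VB) (hr' : r' ∈ insert x VB) (hy' : y' ∈ insert x VB) :
    connEvent ends r y ∩ connEvent ends r' y' =
      sideEvent EB (connEvent ends r y ∩ connEvent ends r' y') := by
  rw [← sideEvent_inter, ← connEvent_eq_sideEventB' h hr hy, ← connEvent_eq_sideEventB' h hr' hy']

omit [Fintype V] [DecidableEq V] [Fintype E] [DecidableEq E] [Field R] [LinearOrder R]
  [IsStrictOrderedRing R] [DecidablePred (· ∈ EA)] in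
/-- `univ` is its own `B`-side event. -/
lemma univ_eq_sideEventB : (Set.univ : Set (Config E)) = sideEvent EB Set.univ := by
  ext ω; simp [mem_sideEvent]

omit [Fintype V] [LinearOrder R] [IsStrictOrderedRing R] in
/-- `EQb3` across the cut. -/
lemma EQb3_cut (h : IsCut ends x ↑VA ↑VB EA EB) (hv : v ∈ VA) (h1 : a₁ ∈ insert x VB)
    (h2 : a₂ ∈ insert x VB) (hb : b ∈ insert x VB) :
    EQb3 p ends a₁ a₂ v b = prob p (connEvent ends v x) * EQb3 p ends a₁ a₂ x b := by
  unfold EQb3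
  rw [LeafStep.prob_T'_inter_v p ends a₁ a₂ v, LeafStep.prob_T_inter_v p ends a₁ a₂ v,
    LeafStep.prob_T_inter_v p ends a₁ a₂ v, LeafStep.prob_T'_inter_v p ends a₁ a₂ v,
    LeafStep.prob_T'_inter_v p ends a₁ a₂ x, LeafStep.prob_T_inter_v p ends a₁ a₂ x,
    LeafStep.prob_T_inter_v p ends a₁ a₂ x, LeafStep.prob_T'_inter_v p ends a₁ a₂ x,
    prob_Q_conn_v_inter h hv h1 h1 h2 _ (connEvent_eq_sideEventB'' h h1 hb),
    prob_Q_conn_v_inter h hv h2 h1 h2 _ (connEvent_eq_sideEventB'' h h2 hb),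
    prob_Q_conn_v_inter h hv h2 h1 h2 _ (connEvent_eq_sideEventB'' h h1 hb),
    prob_Q_conn_v_inter h hv h1 h1 h2 _ (connEvent_eq_sideEventB'' h h2 hb)]
  ring

omit [Fintype V] [LinearOrder R] [IsStrictOrderedRing R] in
/-- `EQb3o` across the cut. -/
lemma EQb3o_cut (h : IsCut ends x ↑VA ↑VB EA EB) (hv : v ∈ VA) (ho : o ∈ insert x VB)
    (h1 : a₁ ∈ insert x VB) (h2 : a₂ ∈ insert x VB) (hb : b ∈ insert x VB) :
    EQb3o p ends o a₁ a₂ v b = prob p (connEvent ends v x) * EQb3o p ends o a₁ a₂ x b := by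
  unfold EQb3o
  rw [LeafStep.prob_T'_inter_v p ends a₁ a₂ v, LeafStep.prob_T'_inter_v p ends a₁ a₂ v,
    LeafStep.prob_T_inter_v p ends a₁ a₂ v, LeafStep.prob_T_inter_v p ends a₁ a₂ v,
    LeafStep.prob_T_inter_v p ends a₁ a₂ v, LeafStep.prob_T_inter_v p ends a₁ a₂ v,
    LeafStep.prob_T'_inter_v p ends a₁ a₂ v, LeafStep.prob_T'_inter_v p ends a₁ a₂ v,
    LeafStep.prob_T'_inter_v p ends a₁ a₂ x, LeafStep.prob_T'_inter_v p ends a₁ a₂ x,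
    LeafStep.prob_T_inter_v p ends a₁ a₂ x, LeafStep.prob_T_inter_v p ends a₁ a₂ x,
    LeafStep.prob_T_inter_v p ends a₁ a₂ x, LeafStep.prob_T_inter_v p ends a₁ a₂ x,
    LeafStep.prob_T'_inter_v p ends a₁ a₂ x, LeafStep.prob_T'_inter_v p ends a₁ a₂ x,
    prob_Q_conn_v_inter h hv h1 h1 h2 _ (connEvent_inter_eq_sideEventB h h1 ho h1 hb),
    prob_Q_conn_v_inter h hv h1 h1 h2 _ (connEvent_inter_eq_sideEventB h h2 ho h1 hb),
    prob_Q_conn_v_inter h hv h2 h1 h2 _ (connEvent_inter_eq_sideEventB h h1 ho h2 hb),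
    prob_Q_conn_v_inter h hv h2 h1 h2 _ (connEvent_inter_eq_sideEventB h h2 ho h2 hb),
    prob_Q_conn_v_inter h hv h2 h1 h2 _ (connEvent_inter_eq_sideEventB h h1 ho h1 hb),
    prob_Q_conn_v_inter h hv h2 h1 h2 _ (connEvent_inter_eq_sideEventB h h2 ho h1 hb),
    prob_Q_conn_v_inter h hv h1 h1 h2 _ (connEvent_inter_eq_sideEventB h h1 ho h2 hb),
    prob_Q_conn_v_inter h hv h1 h1 h2 _ (connEvent_inter_eq_sideEventB h h2 ho h2 hb)]
  ring

omit [Fintype V] [LinearOrder R] [IsStrictOrderedRing R] in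
/-- `EQ3` across the cut. -/
lemma EQ3_cut (h : IsCut ends x ↑VA ↑VB EA EB) (hv : v ∈ VA) (h1 : a₁ ∈ insert x VB)
    (h2 : a₂ ∈ insert x VB) :
    EQ3 p ends a₁ a₂ v = prob p (connEvent ends v x) * EQ3 p ends a₁ a₂ x := by
  unfold EQ3
  have e1 := LeafStep.prob_T'_v p ends a₁ a₂ v
  have e2 := LeafStep.prob_T_v p ends a₁ a₂ v
  have e3 := LeafStep.prob_T'_v p ends a₁ a₂ x
  have e4 := LeafStep.prob_T_v p ends a₁ a₂ x
  rw [e1, e2, e3, e4]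
  have u : ∀ r y : V, avoidAll ends a₂ {a₁} ∩ connEvent ends r y =
      avoidAll ends a₂ {a₁} ∩ (connEvent ends r y ∩ Set.univ) := by
    intro r y; rw [Set.inter_univ]
  rw [u a₁ v, u a₂ v, u a₁ x, u a₂ x, prob_Q_conn_v_inter h hv h1 h1 h2 _ univ_eq_sideEventB,
    prob_Q_conn_v_inter h hv h2 h1 h2 _ univ_eq_sideEventB]
  ring

omit [Fintype V] [LinearOrder R] [IsStrictOrderedRing R] in
/-- `EQ3o` across the cut. -/
lemma EQ3o_cut (h : IsCut ends x ↑VA ↑VB EA EB) (hv : v ∈ VA) (ho : o ∈ insert x VB)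
    (h1 : a₁ ∈ insert x VB) (h2 : a₂ ∈ insert x VB) :
    EQ3o p ends o a₁ a₂ v = prob p (connEvent ends v x) * EQ3o p ends o a₁ a₂ x := by
  unfold EQ3o
  rw [LeafStep.prob_T'_inter_v p ends a₁ a₂ v, LeafStep.prob_T'_inter_v p ends a₁ a₂ v,
    LeafStep.prob_T_inter_v p ends a₁ a₂ v, LeafStep.prob_T_inter_v p ends a₁ a₂ v,
    LeafStep.prob_T'_inter_v p ends a₁ a₂ x, LeafStep.prob_T'_inter_v p ends a₁ a₂ x,
    LeafStep.prob_T_inter_v p ends a₁ a₂ x, LeafStep.prob_T_inter_v p ends a₁ a₂ x,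
    prob_Q_conn_v_inter h hv h1 h1 h2 _ (connEvent_eq_sideEventB'' h h1 ho),
    prob_Q_conn_v_inter h hv h1 h1 h2 _ (connEvent_eq_sideEventB'' h h2 ho),
    prob_Q_conn_v_inter h hv h2 h1 h2 _ (connEvent_eq_sideEventB'' h h1 ho),
    prob_Q_conn_v_inter h hv h2 h1 h2 _ (connEvent_eq_sideEventB'' h h2 ho)]
  ring

omit [Fintype V] in
/-- `PDbo` across the cut. -/
lemma PDbo_cut (h : IsCut ends x ↑VA ↑VB EA EB) (hv : v ∈ VA) (ho : o ∈ insert x VB)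
    (h1 : a₁ ∈ insert x VB) (h2 : a₂ ∈ insert x VB) (hb : b ∈ insert x VB) :
    PDbo p ends o a₁ a₂ v b =
      (1 - prob p (connEvent ends v x)) * LeafStep.mUU p ends o a₁ a₂ b +
        prob p (connEvent ends v x) * PDbo p ends o a₁ a₂ x b := by
  unfold PDbo LeafStep.mUU
  rw [prob_PD_v_inter h hv h1 h2 _ (connEvent_inter_eq_sideEventB h h1 ho h1 hb),
    prob_PD_v_inter h hv h1 h2 _ (connEvent_inter_eq_sideEventB h h2 ho h1 hb),
    prob_PD_v_inter h hv h1 h2 _ (connEvent_inter_eq_sideEventB h h1 ho h2 hb),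
    prob_PD_v_inter h hv h1 h2 _ (connEvent_inter_eq_sideEventB h h2 ho h2 hb)]
  ring

omit [Fintype V] in
/-- `PDb` across the cut. -/
lemma PDb_cut (h : IsCut ends x ↑VA ↑VB EA EB) (hv : v ∈ VA) (h1 : a₁ ∈ insert x VB)
    (h2 : a₂ ∈ insert x VB) (hb : b ∈ insert x VB) :
    PDb p ends a₁ a₂ v b =
      (1 - prob p (connEvent ends v x)) * LeafStep.mU p ends a₁ a₂ b +
        prob p (connEvent ends v x) * PDb p ends a₁ a₂ x b := by
  unfold PDb LeafStep.mU
  rw [prob_PD_v_inter h hv h1 h2 _ (connEvent_eq_sideEventB'' h h1 hb),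
    prob_PD_v_inter h hv h1 h2 _ (connEvent_eq_sideEventB'' h h2 hb)]
  ring

omit [Fintype V] in
/-- `D_o` across the cut. -/
lemma Do_cut (h : IsCut ends x ↑VA ↑VB EA EB) (hv : v ∈ VA) (ho : o ∈ insert x VB)
    (h1 : a₁ ∈ insert x VB) (h2 : a₂ ∈ insert x VB) :
    Do p ends o a₁ a₂ v =
      (1 - prob p (connEvent ends v x)) * LeafStep.mU p ends a₁ a₂ o +
        prob p (connEvent ends v x) * Do p ends o a₁ a₂ x := by
  unfold Do LeafStep.mU
  rw [prob_PD_v_inter h hv h1 h2 _ (connEvent_eq_sideEventB'' h h1 ho),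
    prob_PD_v_inter h hv h1 h2 _ (connEvent_eq_sideEventB'' h h2 ho)]
  ring

omit [Fintype V] in
/-- `D` across the cut. -/
lemma D_cut (h : IsCut ends x ↑VA ↑VB EA EB) (hv : v ∈ VA) (h1 : a₁ ∈ insert x VB)
    (h2 : a₂ ∈ insert x VB) :
    prob p (PDEvent ends a₁ a₂ v) =
      (1 - prob p (connEvent ends v x)) * prob p (avoidAll ends a₂ {a₁}) +
        prob p (connEvent ends v x) * prob p (PDEvent ends a₁ a₂ x) := by
  have := prob_PD_v_inter (p := p) h hv h1 h2 Set.univ univ_eq_sideEventB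
  simpa only [Set.inter_univ] using this

omit [Fintype V] in
/-- **The (HCOV)-level Bernstein expansion along a pendant part**:
`Gc(v) = (1 − c)²·T₀ + 2c(1 − c)·R½(x) + c²·Gc(x)`, `c = P(v ↔ x)`. -/
theorem Gc_cut (h : IsCut ends x ↑VA ↑VB EA EB) (hv : v ∈ VA) (ho : o ∈ insert x VB)
    (h1 : a₁ ∈ insert x VB) (h2 : a₂ ∈ insert x VB) (hb : b ∈ insert x VB) :
    Gc p ends o a₁ a₂ v b =
      (1 - prob p (connEvent ends v x)) ^ 2 * LeafStep.T0 p ends o a₁ a₂ b +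
        2 * prob p (connEvent ends v x) * (1 - prob p (connEvent ends v x)) *
          LeafStep.Rhalf p ends o a₁ a₂ x b +
        prob p (connEvent ends v x) ^ 2 * Gc p ends o a₁ a₂ x b := by
  unfold LeafStep.Rhalf LeafStep.T0 LeafStep.Gc1
  unfold Gc DEF
  rw [EQb3_cut h hv h1 h2 hb, EQb3o_cut h hv ho h1 h2 hb, EQ3_cut h hv h1 h2, EQ3o_cut h hv ho h1 h2,
    PDbo_cut h hv ho h1 h2 hb, PDb_cut h hv h1 h2 hb, Do_cut h hv ho h1 h2, D_cut h hv h1 h2]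
  have hmx : LeafStep.mU p ends a₁ a₂ x = prob p (avoidAll ends a₂ {a₁}) - prob p (PDEvent ends a₁ a₂ x) := by
    unfold LeafStep.mU
    rw [LeafStep.prob_PD_v]
    ring
  rw [hmx]
  ring

/-- **(HCOV) behind a pendant part from (HCOV) and row 2′LEAF at the cut vertex.** -/
theorem HCov_cut_of_leafRow (hp : IsProbVec p) (h : IsCut ends x ↑VA ↑VB EA EB) (hv : v ∈ VA)
    (ho : o ∈ insert x VB) (h1 : a₁ ∈ insert x VB) (h2 : a₂ ∈ insert x VB) (hb : b ∈ insert x VB)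
    (hx : HCov p ends o a₁ a₂ x b) (hrow : LeafStep.LeafRow p ends o a₁ a₂ x b) :
    HCov p ends o a₁ a₂ v b := by
  unfold HCov
  rw [Gc_cut h hv ho h1 h2 hb]
  have hc0 := prob_nonneg hp (connEvent ends v x)
  have hc1 : prob p (connEvent ends v x) ≤ 1 := by
    have := prob_mono hp (Set.subset_univ (connEvent ends v x))
    rwa [prob_univ] at this
  have hT := LeafStep.T0_nonneg p ends hp o a₁ a₂ b
  unfold HCov at hx
  unfold LeafStep.LeafRow at hrow
  have h1c : 0 ≤ 1 - prob p (connEvent ends v x) := sub_nonneg.2 hc1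
  refine add_nonneg (add_nonneg (mul_nonneg (pow_nonneg h1c 2) hT) ?_) (mul_nonneg (pow_nonneg hc0 2) hx)
  exact mul_nonneg (mul_nonneg (mul_nonneg (by norm_num) hc0) h1c) hrow

end CutMoments

end A3Fibre

end CovForm

end Summit.Ventures.PercRepro2
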